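import Summits.QuantumFields.BalabanUV.T4Continuum.Support.NE7SpectralClusterProjections
import Summits.QuantumFields.BalabanUV.T4Continuum.Support.NE7CommutingUnitariesResolution
import HarnessLib

/-!
# NE7AlmostCommutingUnitaries — (ACU): UNITARIES NEAR A COMMUTING UNITARY FAMILY HAVE UNITARY APPROXIMANTS THAT COMMUTE WITH THE COMMUTANT OF THE GIVEN ONES AND KEEP
# THE TRIVIAL 4-LETTER WORDS (file S3b-3b of the `k`-uniform stabiliser lifting programme: the matrix-analysis letter of ✓ `NE7SymmetricFlatNearOfACU`)

Cell `pub-balaban`, rung (B)+1 sub-cell t4, lineage `b2b-balaban-t4-ne7b-p1` (row NE7b OWNER + CRUX PROVER; junction service for row NE7, ruling R-OWNER-149-1 (2)),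
generation 159.  Memo `t4/b2b-balaban-t4-ne7b-p1/g159/records/S3-BRIEF.md` §2 (b).
THE ARGUMENT.  ✓ `NE7CommutingUnitariesResolution`: one self-adjoint real combination `H = Σ (t_i Re c_i + t′_i Im c_i)` diagonalises the commuting unitaries, `c_i = Σ_{k∈σ(H)} ĉ_i(k) E_k`,
`|ĉ| = 1`, trivial words have trivial symbols.  For unitaries `a_i` near `c_i` form THE SAME combination `H_a`; the spectrum of `H_a` is within `ρ` of the separated finite
set `σ(H)` as soon as `‖Π(H_a)‖ < ρ^{#σ(H)}` (✓ `NE7SpectralClusterProjections.localisation_of_norm_aeval_lt`; `Π(H) = 0`, continuity of `a ↦ Π(H_a)`); the cluster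
projections `R_k = 𝟙_{|u−k|<ρ₀}(H_a)` form an orthogonal resolution commuting with the commutant of the `a_i` (a unitary commuting with `z` has its adjoint commuting with `z`),
`f_i := Σ_k ĉ_i(k) R_k` is unitary, keeps the trivial words, and `‖R_k − E_k‖ ≤ ‖R_k − q_k(H_a)‖ + ‖q_k(H_a) − q_k(H)‖` is small (`q_k` the Lagrange basis polynomial on `σ(H)`:
on `σ(H_a)` the indicator equals `q_k` at the nearby point of `σ(H)`, uniform continuity of `q_k` on a compact interval; continuity of `a ↦ q_k(H_a)`).
WHAT ([folklore]; 0 def, 0 sorry).  **`acu`** (any finite index type) and **`acu_curried`** — EXACTLY the hypothesis `hACU` of ✓ `NE7SymmetricFlatNearOfACU.exists_symmetric_flat_near_of_ACU`.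
HONEST FRAMING (page 1): elementary finite-dimensional spectral perturbation theory; nothing of Bałaban's; NOT NE7, NOT NE3; row NE7b NOT PRINTED ∕ NOT PROVED; spine 0∕9; finite T⁴
rung (B)+1 — NOT infinite volume, NOT mass gap, NOT BetaPertH, NOT Clay.
-/

set_option autoImplicit false

open scoped Matrix.Norms.L2Operator BigOperators ComplexConjugate Topology
open Finset Polynomial

namespace Summit.QuantumFields.BalabanUV.T4Continuum.NE7AlmostCommutingUnitaries

open NE7SpectralResolution (sum_specProj)
open NE7CommutingUnitariesResolution (commute_star_of_unitary isSelfAdjoint_re isSelfAdjoint_im commuting_unitaries_resolution)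
open NE7SpectralClusterProjections (sum_cluster commute_cluster sum_smul_cluster_mem_unitary word_sum_smul_cluster localisation_of_norm_aeval_lt
  norm_cluster_sub_aeval_le)

noncomputable section

variable {n : Type} [Fintype n] [DecidableEq n]

omit [Fintype n] [DecidableEq n] in
/-- The combination `b ↦ Σ_i (t_i Re b_i + t′_i Im b_i)` is continuous. [folklore] -/
theorem continuous_comb {ι : Type} [Fintype ι] (t t' : ι → ℝ) :
    Continuous fun b : ι → Matrix n n ℂ =>
      ∑ i, (((t i : ℝ) : ℂ) • (((1 / 2 : ℂ)) • (b i + star (b i))) + ((t' i : ℝ) : ℂ) • ((-Complex.I / 2) • (b i - star (b i)))) := by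
  refine continuous_finsetSum _ fun i _ => ?_
  have hb : Continuous fun b : ι → Matrix n n ℂ => b i := continuous_apply i
  exact (((hb.add hb.star).const_smul (1 / 2 : ℂ)).const_smul ((t i : ℝ) : ℂ)).add
    (((hb.sub hb.star).const_smul (-Complex.I / 2)).const_smul ((t' i : ℝ) : ℂ))

omit [Fintype n] [DecidableEq n] in
/-- The combination is self-adjoint for every family. [folklore] -/
theorem isSelfAdjoint_comb {ι : Type} [Fintype ι] (t t' : ι → ℝ) (b : ι → Matrix n n ℂ) :
    IsSelfAdjoint (∑ i, (((t i : ℝ) : ℂ) • (((1 / 2 : ℂ)) • (b i + star (b i))) + ((t' i : ℝ) : ℂ) • ((-Complex.I / 2) • (b i - star (b i))))) := by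
  have hr : ∀ r : ℝ, IsSelfAdjoint ((r : ℂ)) := fun r => by rw [IsSelfAdjoint, Complex.star_def, Complex.conj_ofReal]
  exact Finset.sum_induction _ (fun x => IsSelfAdjoint x) (fun a b ha hb => ha.add hb) (by simp)
    (fun i _ => ((hr _).smul (isSelfAdjoint_re (b i))).add ((hr _).smul (isSelfAdjoint_im (b i))))

/-- Anything commuting with every unitary `b_i` commutes with the combination. [folklore] -/
theorem commute_comb {ι : Type} [Fintype ι] (t t' : ι → ℝ) {b : ι → Matrix n n ℂ} (hb : ∀ i, b i ∈ unitary (Matrix n n ℂ)) {z : Matrix n n ℂ}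
    (hz : ∀ i, z * b i = b i * z) :
    Commute z (∑ i, (((t i : ℝ) : ℂ) • (((1 / 2 : ℂ)) • (b i + star (b i))) + ((t' i : ℝ) : ℂ) • ((-Complex.I / 2) • (b i - star (b i))))) := by
  refine Commute.sum_right _ _ _ fun i _ => ?_
  have h1 : Commute z (b i) := hz i
  have h2 : Commute z (star (b i)) := commute_star_of_unitary (hb i) (hz i)
  exact (((h1.add_right h2).smul_right _).smul_right _).add_right (((h1.sub_right h2).smul_right _).smul_right _)

/-- **(ACU)** — see the module docstring. [folklore] -/
theorem acu [Nonempty n] {ι : Type} [Fintype ι] [DecidableEq ι] (c : ι → Matrix n n ℂ)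
    (hcu : ∀ i, c i ∈ unitary (Matrix n n ℂ)) (hcomm : ∀ i j, c i * c j = c j * c i) {ε : ℝ} (hε : 0 < ε) :
    ∃ δ : ℝ, 0 < δ ∧ ∀ a : ι → Matrix n n ℂ, (∀ i, a i ∈ unitary (Matrix n n ℂ)) → (∀ i, ‖a i - c i‖ ≤ δ) →
      ∃ f : ι → Matrix n n ℂ, (∀ i, f i ∈ unitary (Matrix n n ℂ)) ∧ (∀ i, ‖f i - c i‖ ≤ ε) ∧
        (∀ z : Matrix n n ℂ, (∀ i, z * a i = a i * z) → ∀ i, z * f i = f i * z) ∧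
        (∀ i₁ i₂ i₃ i₄ : ι, c i₁ * c i₂ * star (c i₃) * star (c i₄) = 1 → f i₁ * f i₂ * star (f i₃) * star (f i₄) = 1) := by
  classical
  obtain ⟨t, t', ĉ, hHsa, -, hspec, hwords, hcsum⟩ := commuting_unitaries_resolution c hcu hcomm
  set Hf : (ι → Matrix n n ℂ) → Matrix n n ℂ := fun b =>
    ∑ i, (((t i : ℝ) : ℂ) • (((1 / 2 : ℂ)) • (b i + star (b i))) + ((t' i : ℝ) : ℂ) • ((-Complex.I / 2) • (b i - star (b i)))) with hHf
  have hHfc : Hf c = ∑ i, (((t i : ℝ) : ℂ) • (((1 / 2 : ℂ)) • (c i + star (c i))) + ((t' i : ℝ) : ℂ) • ((-Complex.I / 2) • (c i - star (c i)))) := rfl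
  rw [← hHfc] at hHsa hspec hwords hcsum
  have hsa : ∀ b, IsSelfAdjoint (Hf b) := fun b => isSelfAdjoint_comb t t' b
  have hcont : Continuous Hf := continuous_comb t t'
  -- the finite spectrum `S` of `H = Hf c`, non-empty
  set S : Finset ℝ := (Matrix.finite_real_spectrum (A := Hf c)).toFinset with hS
  have hSmem : ∀ k, k ∈ S ↔ k ∈ spectrum ℝ (Hf c) := fun k => by rw [hS, Set.Finite.mem_toFinset]
  have hSne : S.Nonempty := by
    by_contra hemp
    rw [Finset.not_nonempty_iff_eq_empty] at hemp
    have h := sum_specProj (Hf c) hHsa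
    rw [← hS, hemp, Finset.sum_empty] at h
    exact zero_ne_one h
  clear_value S
  -- separation `ρ₀ ≤ 1`
  obtain ⟨ρ₀, hρ₀, hρ₀1, hsep⟩ : ∃ ρ₀ : ℝ, 0 < ρ₀ ∧ ρ₀ ≤ 1 ∧ ∀ k ∈ S, ∀ k' ∈ S, k ≠ k' → 2 * ρ₀ ≤ |k - k'| := by
    set D : Finset ℝ := ((S ×ˢ S).filter (fun p => p.1 ≠ p.2)).image (fun p => |p.1 - p.2|) with hD
    by_cases hDn : D.Nonempty
    · have hDpos : 0 < D.min' hDn := by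
        rw [Finset.lt_min'_iff]
        intro y hy
        rw [hD, Finset.mem_image] at hy
        obtain ⟨p, hp, hpe⟩ := hy
        rw [Finset.mem_filter] at hp
        rw [← hpe]
        exact abs_pos.mpr (sub_ne_zero.mpr hp.2)
      refine ⟨min 1 (D.min' hDn / 2), lt_min one_pos (by linarith), min_le_left _ _, fun k hk k' hk' hkk => ?_⟩
      have hmem : |k - k'| ∈ D := by
        rw [hD, Finset.mem_image]
        exact ⟨(k, k'), Finset.mem_filter.mpr ⟨Finset.mem_product.mpr ⟨hk, hk'⟩, hkk⟩, rfl⟩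
      have hle := Finset.min'_le D _ hmem
      linarith [min_le_right (1 : ℝ) (D.min' hDn / 2)]
    · refine ⟨1, one_pos, le_rfl, fun k hk k' hk' hkk => ?_⟩
      exfalso; apply hDn
      exact ⟨|k - k'|, by rw [hD, Finset.mem_image]; exact ⟨(k, k'), Finset.mem_filter.mpr ⟨Finset.mem_product.mpr ⟨hk, hk'⟩, hkk⟩, rfl⟩⟩
  -- Lagrange basis polynomials on `S`; the exact spectral projections as polynomials of `H`
  set q : ℝ → ℝ[X] := fun k => Lagrange.interpolate S id (fun u => if u = k then (1 : ℝ) else 0) with hq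
  have hqS : ∀ k, ∀ k' ∈ S, (q k).eval k' = if k' = k then (1 : ℝ) else 0 := by
    intro k k' hk'
    have h1 := Lagrange.eval_interpolate_at_node (r := fun u => if u = k then (1 : ℝ) else 0) (v := id) (s := S) (Set.injOn_id _) hk'
    simpa [hq] using h1
  have hE : ∀ k, cfc (fun u : ℝ => if u = k then (1 : ℝ) else 0) (Hf c) = aeval (Hf c) (q k) := by
    intro k
    rw [← cfc_polynomial (q k) (Hf c)]
    exact cfc_congr fun u hu => (hqS k u ((hSmem u).mpr hu)).symm
  -- the annihilating polynomial `Π`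
  set Pann : ℝ[X] := ∏ k ∈ S, (X - C k) with hPann
  have hPannc : aeval (Hf c) Pann = 0 := by
    rw [← cfc_polynomial Pann (Hf c)]
    have hcongr : (spectrum ℝ (Hf c)).EqOn Pann.eval (fun _ => 0) := by
      intro u hu
      simp only [hPann, Polynomial.eval_prod, eval_sub, eval_X, eval_C]
      exact Finset.prod_eq_zero ((hSmem u).mpr hu) (sub_self u)
    rw [cfc_congr hcongr, cfc_const_zero]
  -- uniform continuity of the `q_k` on a compact interval around `S`
  obtain ⟨ε', hε'⟩ : ∃ ε' : ℝ, ε' = ε / (2 * ((S.card : ℝ) + 1)) := ⟨_, rfl⟩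
  have hcard0 : (0 : ℝ) ≤ (S.card : ℝ) := Nat.cast_nonneg _
  have hε'0 : 0 < ε' := by rw [hε']; exact div_pos hε (by linarith)
  set I : Set ℝ := Set.Icc (S.min' hSne - 1) (S.max' hSne + 1) with hI
  have huc : ∀ k ∈ S, ∃ δk : ℝ, 0 < δk ∧ ∀ u ∈ I, ∀ v ∈ I, dist u v < δk → dist ((q k).eval u) ((q k).eval v) < ε' := by
    intro k _
    have h := (isCompact_Icc.uniformContinuousOn_of_continuous (Polynomial.continuous (q k)).continuousOn :
      UniformContinuousOn (fun u => (q k).eval u) I)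
    rw [Metric.uniformContinuousOn_iff] at h
    exact h ε' hε'0
  choose! δq hδq hquc using huc
  set δ₁ : ℝ := S.inf' hSne δq with hδ₁
  have hδ₁0 : 0 < δ₁ := by rw [hδ₁, Finset.lt_inf'_iff]; exact fun k hk => hδq k hk
  have hδ₁le : ∀ k ∈ S, δ₁ ≤ δq k := fun k hk => Finset.inf'_le _ hk
  set ρ : ℝ := min ρ₀ (δ₁ / 2) with hρdef
  have hρ0 : 0 < ρ := lt_min hρ₀ (by linarith)
  have hρρ₀ : ρ ≤ ρ₀ := min_le_left _ _
  have hρδ₁ : ρ < δ₁ := (min_le_right _ _).trans_lt (by linarith)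
  -- continuity radii at `c`
  have hΦ₀ : ContinuousAt (fun b : ι → Matrix n n ℂ => aeval (Hf b) Pann) c := ((Polynomial.continuous_aeval Pann).comp hcont).continuousAt
  obtain ⟨δA, hδA, hA⟩ := Metric.continuousAt_iff.mp hΦ₀ (ρ ^ S.card) (by positivity)
  have hΦk : ∀ k ∈ S, ∃ δk : ℝ, 0 < δk ∧ ∀ b : ι → Matrix n n ℂ, dist b c < δk → dist (aeval (Hf b) (q k)) (aeval (Hf c) (q k)) < ε' := by
    intro k _
    have h : ContinuousAt (fun b : ι → Matrix n n ℂ => aeval (Hf b) (q k)) c := ((Polynomial.continuous_aeval (q k)).comp hcont).continuousAt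
    exact Metric.continuousAt_iff.mp h ε' hε'0
  choose! δB hδB hB using hΦk
  set δ₂ : ℝ := S.inf' hSne δB with hδ₂
  have hδ₂0 : 0 < δ₂ := by rw [hδ₂, Finset.lt_inf'_iff]; exact fun k hk => hδB k hk
  have hδ₂le : ∀ k ∈ S, δ₂ ≤ δB k := fun k hk => Finset.inf'_le _ hk
  -- THE RADIUS
  refine ⟨min δA δ₂ / 2, by positivity, fun a hau hac => ?_⟩
  have hdist : dist a c < min δA δ₂ := by
    have h1 : dist a c ≤ min δA δ₂ / 2 := (dist_pi_le_iff (by positivity)).mpr fun i => by rw [dist_eq_norm]; exact hac i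
    linarith [lt_min hδA hδ₂0]
  have hdA : dist a c < δA := hdist.trans_le (min_le_left _ _)
  have hdB : ∀ k ∈ S, dist a c < δB k := fun k hk => (hdist.trans_le (min_le_right _ _)).trans_le (hδ₂le k hk)
  -- localisation of `σ(H_a)`
  have hloc : ∀ u ∈ spectrum ℝ (Hf a), ∃ k ∈ S, |u - k| < ρ := by
    refine localisation_of_norm_aeval_lt (Hf a) S hρ0 ?_
    have h := hA hdA
    rwa [hPannc, dist_zero_right] at h
  -- the cluster projections and the approximants
  set R : ℝ → Matrix n n ℂ := fun k => cfc (fun u : ℝ => if |u - k| < ρ₀ then (1 : ℝ) else 0) (Hf a) with hR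
  have hsumR : ∑ k ∈ S, R k = 1 := sum_cluster (Hf a) (hsa a) hsep hρρ₀ hloc
  set f : ι → Matrix n n ℂ := fun i => ∑ k ∈ S, ĉ i k • R k with hf
  refine ⟨f, fun i => ?_, fun i => ?_, fun z hz i => ?_, fun i₁ i₂ i₃ i₄ hw => ?_⟩
  · -- unitary
    exact sum_smul_cluster_mem_unitary (Hf a) hsep hsumR fun k hk => (hspec i k ((hSmem k).mp hk)).1
  · -- close to `c i`
    have hdiff : f i - c i = ∑ k ∈ S, ĉ i k • (R k - cfc (fun u : ℝ => if u = k then (1 : ℝ) else 0) (Hf c)) := by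
      rw [hcsum i, hf, ← Finset.sum_sub_distrib]
      exact Finset.sum_congr rfl fun k _ => by rw [smul_sub]
    rw [hdiff]
    have hterm : ∀ k ∈ S, ‖ĉ i k • (R k - cfc (fun u : ℝ => if u = k then (1 : ℝ) else 0) (Hf c))‖ ≤ 2 * ε' := by
      intro k hk
      rw [norm_smul, (hspec i k ((hSmem k).mp hk)).1, one_mul, hE k]
      have h1 : ‖R k - aeval (Hf a) (q k)‖ ≤ ε' := by
        refine norm_cluster_sub_aeval_le (Hf a) (hsa a) ρ₀ k (q k) hε'0.le fun u hu => ?_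
        obtain ⟨k₀, hk₀, hu0⟩ := hloc u hu
        have hind : (if |u - k| < ρ₀ then (1 : ℝ) else 0) = (q k).eval k₀ := by
          rw [hqS k k₀ hk₀]
          by_cases hkk : k₀ = k
          · subst hkk; simp [hu0.trans_le hρρ₀]
          · have hfar : ¬ |u - k| < ρ₀ := by
              intro h1
              have h3 := hsep k hk k₀ hk₀ (Ne.symm hkk)
              have h4 : |k - k₀| ≤ |u - k| + |u - k₀| := by
                calc |k - k₀| = |(u - k₀) - (u - k)| := by ring_nf
                  _ ≤ |u - k₀| + |u - k| := abs_sub _ _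
                  _ = |u - k| + |u - k₀| := add_comm _ _
              linarith
            simp [hfar, hkk]
        rw [hind]
        have hk₀I : k₀ ∈ I := ⟨by linarith [Finset.min'_le S k₀ hk₀], by linarith [Finset.le_max' S k₀ hk₀]⟩
        have huI : u ∈ I := by
          have h5 : |u - k₀| < 1 := hu0.trans_le (hρρ₀.trans hρ₀1)
          rw [abs_lt] at h5
          exact ⟨by linarith [Finset.min'_le S k₀ hk₀], by linarith [Finset.le_max' S k₀ hk₀]⟩
        have h6 := hquc k hk k₀ hk₀I u huI (by rw [dist_comm, Real.dist_eq]; exact hu0.trans_le (le_of_lt (hρδ₁.trans_le (hδ₁le k hk))))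
        rw [Real.dist_eq] at h6
        exact h6.le
      have h2 : ‖aeval (Hf a) (q k) - aeval (Hf c) (q k)‖ < ε' := by
        have h := hB k hk a (hdB k hk)
        rwa [dist_eq_norm] at h
      calc ‖R k - aeval (Hf c) (q k)‖ = ‖(R k - aeval (Hf a) (q k)) + (aeval (Hf a) (q k) - aeval (Hf c) (q k))‖ := by rw [sub_add_sub_cancel]
        _ ≤ ‖R k - aeval (Hf a) (q k)‖ + ‖aeval (Hf a) (q k) - aeval (Hf c) (q k)‖ := norm_add_le _ _
        _ ≤ 2 * ε' := by linarith
    calc ‖∑ k ∈ S, ĉ i k • (R k - cfc (fun u : ℝ => if u = k then (1 : ℝ) else 0) (Hf c))‖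
        ≤ ∑ k ∈ S, ‖ĉ i k • (R k - cfc (fun u : ℝ => if u = k then (1 : ℝ) else 0) (Hf c))‖ := norm_sum_le _ _
      _ ≤ ∑ k ∈ S, 2 * ε' := Finset.sum_le_sum hterm
      _ = S.card * (2 * ε') := by rw [Finset.sum_const, nsmul_eq_mul]
      _ ≤ ε := by
          have h7 : ε' * (2 * ((S.card : ℝ) + 1)) = ε := by
            rw [hε']; exact div_mul_cancel₀ _ (ne_of_gt (by linarith))
          linarith
  · -- commutes with the commutant of `a`
    have hzH : Commute z (Hf a) := commute_comb t t' hau hz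
    have h := Commute.sum_right S (fun k => ĉ i k • R k) z fun k _ => (commute_cluster hzH ρ₀ k).smul_right (ĉ i k)
    exact h.eq
  · -- words
    exact word_sum_smul_cluster (Hf a) hsep hsumR (ĉ i₁) (ĉ i₂) (ĉ i₃) (ĉ i₄) fun k hk => hwords i₁ i₂ i₃ i₄ hw k ((hSmem k).mp hk)

/-- **(ACU), curried form** — literally the hypothesis `hACU` of ✓ `NE7SymmetricFlatNearOfACU.exists_symmetric_flat_near_of_ACU` (index = loops `(r, κ)`,
`r : Fin d → Fin N`, `κ : Fin d`). [folklore] -/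
theorem acu_curried [Nonempty n] {d N : ℕ} :
    ∀ (c : (Fin d → Fin N) → Fin d → Matrix n n ℂ), (∀ r κ, c r κ ∈ unitary (Matrix n n ℂ)) →
      (∀ r κ r' κ', c r κ * c r' κ' = c r' κ' * c r κ) →
      ∀ ε : ℝ, 0 < ε → ∃ δ : ℝ, 0 < δ ∧ ∀ (a : (Fin d → Fin N) → Fin d → Matrix n n ℂ), (∀ r κ, a r κ ∈ unitary (Matrix n n ℂ)) →
        (∀ r κ, ‖a r κ - c r κ‖ ≤ δ) →
        ∃ f : (Fin d → Fin N) → Fin d → Matrix n n ℂ, (∀ r κ, f r κ ∈ unitary (Matrix n n ℂ)) ∧ (∀ r κ, ‖f r κ - c r κ‖ ≤ ε) ∧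
          (∀ z : Matrix n n ℂ, (∀ r κ, z * a r κ = a r κ * z) → ∀ r κ, z * f r κ = f r κ * z) ∧
          (∀ r₁ κ₁ r₂ κ₂ r₃ κ₃ r₄ κ₄, c r₁ κ₁ * c r₂ κ₂ * star (c r₃ κ₃) * star (c r₄ κ₄) = 1 →
            f r₁ κ₁ * f r₂ κ₂ * star (f r₃ κ₃) * star (f r₄ κ₄) = 1) := by
  classical
  intro c hcu hcomm ε hε
  obtain ⟨δ, hδ, h⟩ := acu (ι := (Fin d → Fin N) × Fin d) (fun p => c p.1 p.2) (fun p => hcu p.1 p.2)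
    (fun p p' => hcomm p.1 p.2 p'.1 p'.2) hε
  refine ⟨δ, hδ, fun a hau hac => ?_⟩
  obtain ⟨f, hfu, hfc, hfz, hfw⟩ := h (fun p => a p.1 p.2) (fun p => hau p.1 p.2) (fun p => hac p.1 p.2)
  exact ⟨fun r κ => f (r, κ), fun r κ => hfu (r, κ), fun r κ => hfc (r, κ),
    fun z hz r κ => hfz z (fun p => hz p.1 p.2) (r, κ),
    fun r₁ κ₁ r₂ κ₂ r₃ κ₃ r₄ κ₄ hw => hfw (r₁, κ₁) (r₂, κ₂) (r₃, κ₃) (r₄, κ₄) hw⟩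

end

end Summit.QuantumFields.BalabanUV.T4Continuum.NE7AlmostCommutingUnitaries
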